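/-
Copyright (c) 2026. All rights reserved.
Released under Apache 2.0 license as described in the file LICENSE.
Authors: abc-iut cell — seat abc-iut-L6-t15 (gen 3): proof-only companion to `HolomorphicCores`
([AbsTopIII] Prop 2.5), no new definitions.
-/
import Literature.AnabelianGeometry.AbsoluteAnabelian.ParallelogramsPlanarRecovered

/-!
# Planar geometry behind [AbsTopIII] Prop 2.5, IX: frames and the orientation sign

Proof-only companion (no definitions) to `HolomorphicCores.lean`, continuing
`ParallelogramsPlanarRecovered`.  For an open `U ⊆ ℂ`, `𝒮(U) ⊆ 𝒬 ⊆ 𝒫(U)` and `p ∈ U` (Prop 2.5 (d)):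

* a FRAME `(P, (S₁, S₂))` at `p` — two distinct sides of a recovered parallelogram `P` meeting exactly in
  `p` — is given by a corner: `P = openParallelogram p e₁ e₂`, `S₁ = [p, p + e₁]`, `S₂ = [p, p + e₂]` with
  `e₁, e₂` `ℝ`-independent; conversely such data with `P̄ ⊆ U` is a frame;
* STRICT CO-ORIENTATION preserves the sign of `det(e₁, e₂)`;
* at every point of `U` there are frames of both signs.

Refereed classical mathematics (S. Mochizuki, *Topics in absolute anabelian geometry III*, §2; kurims
pages); nothing here bears on the disputed parts of IUT.
-/

namespace Literature.AnabelianGeometry.AbsoluteAnabelian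

open _root_.Complex _root_.Set _root_.Topology _root_.Filter _root_.Metric

noncomputable section

/-! ### Two edges of the unit square: equal, opposite, or adjacent -/

/-- Two edges of the unit square are equal, disjoint, or a horizontal and a vertical one (in some order).
(Auxiliary.) [cite: MochizukiAbsTopIII2015, Proposition 2.5 (proof) pp.55–57] -/
theorem sq_edges_cases {E E' : Set ℂ}
    (hE : E = Icc 0 1 ×ℂ {(0 : ℝ)} ∨ E = Icc 0 1 ×ℂ {(1 : ℝ)} ∨ E = {(0 : ℝ)} ×ℂ Icc 0 1 ∨
      E = {(1 : ℝ)} ×ℂ Icc 0 1)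
    (hE' : E' = Icc 0 1 ×ℂ {(0 : ℝ)} ∨ E' = Icc 0 1 ×ℂ {(1 : ℝ)} ∨ E' = {(0 : ℝ)} ×ℂ Icc 0 1 ∨
      E' = {(1 : ℝ)} ×ℂ Icc 0 1) :
    E = E' ∨ E ∩ E' = ∅ ∨ ∃ s t : ℝ, (s = 0 ∨ s = 1) ∧ (t = 0 ∨ t = 1) ∧
      ((E = Icc 0 1 ×ℂ {t} ∧ E' = {s} ×ℂ Icc 0 1) ∨ (E = {s} ×ℂ Icc 0 1 ∧ E' = Icc 0 1 ×ℂ {t})) := by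
  have d01 : (Icc (0 : ℝ) 1 ×ℂ {(0 : ℝ)}) ∩ (Icc (0 : ℝ) 1 ×ℂ {(1 : ℝ)}) = ∅ := by
    ext p; simp [mem_reProdIm]; intro _ _ h; norm_num [h]
  have d01' : ({(0 : ℝ)} ×ℂ Icc (0 : ℝ) 1) ∩ ({(1 : ℝ)} ×ℂ Icc (0 : ℝ) 1) = ∅ := by
    ext p; simp [mem_reProdIm]; intro h; norm_num [h]
  rcases hE with rfl | rfl | rfl | rfl <;> rcases hE' with rfl | rfl | rfl | rfl <;>
    first
    | exact Or.inl rfl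
    | exact Or.inr (Or.inl d01)
    | exact Or.inr (Or.inl (by rw [inter_comm]; exact d01))
    | exact Or.inr (Or.inl d01')
    | exact Or.inr (Or.inl (by rw [inter_comm]; exact d01'))
    | exact Or.inr (Or.inr ⟨_, _, Or.inl rfl, Or.inl rfl, Or.inl ⟨rfl, rfl⟩⟩)
    | exact Or.inr (Or.inr ⟨_, _, Or.inl rfl, Or.inr rfl, Or.inl ⟨rfl, rfl⟩⟩)
    | exact Or.inr (Or.inr ⟨_, _, Or.inr rfl, Or.inl rfl, Or.inl ⟨rfl, rfl⟩⟩)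
    | exact Or.inr (Or.inr ⟨_, _, Or.inr rfl, Or.inr rfl, Or.inl ⟨rfl, rfl⟩⟩)
    | exact Or.inr (Or.inr ⟨_, _, Or.inl rfl, Or.inl rfl, Or.inr ⟨rfl, rfl⟩⟩)
    | exact Or.inr (Or.inr ⟨_, _, Or.inl rfl, Or.inr rfl, Or.inr ⟨rfl, rfl⟩⟩)
    | exact Or.inr (Or.inr ⟨_, _, Or.inr rfl, Or.inl rfl, Or.inr ⟨rfl, rfl⟩⟩)
    | exact Or.inr (Or.inr ⟨_, _, Or.inr rfl, Or.inr rfl, Or.inr ⟨rfl, rfl⟩⟩)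

/-! ### Reparametrising a parallelogram from any corner -/

/-- A parallelogram seen from the corner `(s₀, t₀)` of its frame (`s₀, t₀ ∈ {0,1}`), with the edge vectors
re-signed accordingly. (Auxiliary.) [cite: MochizukiAbsTopIII2015, Proposition 2.5 (proof) pp.55–57] -/
theorem openParallelogram_corner {z v w : ℂ} {s₀ t₀ : ℝ} (hs : s₀ = 0 ∨ s₀ = 1) (ht : t₀ = 0 ∨ t₀ = 1) :
    openParallelogram (z + (s₀ : ℂ) * v + (t₀ : ℂ) * w) (((1 - 2 * s₀ : ℝ) : ℂ) * v) (((1 - 2 * t₀ : ℝ) : ℂ) * w) =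
      openParallelogram z v w := by
  ext x
  simp only [openParallelogram, mem_setOf_eq]
  constructor
  · rintro ⟨s, t, h1, h2, h3, h4, rfl⟩
    refine ⟨s₀ + (1 - 2 * s₀) * s, t₀ + (1 - 2 * t₀) * t, ?_, ?_, ?_, ?_, by push_cast; ring⟩ <;>
      rcases hs with rfl | rfl <;> rcases ht with rfl | rfl <;> linarith
  · rintro ⟨s, t, h1, h2, h3, h4, rfl⟩
    refine ⟨(s - s₀) / (1 - 2 * s₀), (t - t₀) / (1 - 2 * t₀), ?_, ?_, ?_, ?_, ?_⟩ <;>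
      rcases hs with rfl | rfl <;> rcases ht with rfl | rfl <;>
      first
      | (norm_num; linarith)
      | (push_cast; ring)

/-- The horizontal edge at height `t₀` seen from the corner `(s₀, t₀)`.
(Auxiliary.) [cite: MochizukiAbsTopIII2015, Proposition 2.5 (proof) pp.55–57] -/
theorem image_frame_horizontal_corner {z v w : ℂ} {A : ℂ → ℂ}
    (hA : ∀ p : ℂ, A p = z + (p.re : ℂ) * v + (p.im : ℂ) * w) {s₀ t₀ : ℝ} (hs : s₀ = 0 ∨ s₀ = 1) :
    A '' (Icc 0 1 ×ℂ {t₀}) = segment ℝ (z + (s₀ : ℂ) * v + (t₀ : ℂ) * w)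
      (z + (s₀ : ℂ) * v + (t₀ : ℂ) * w + ((1 - 2 * s₀ : ℝ) : ℂ) * v) := by
  rw [image_frame_Icc_const hA]
  rcases hs with rfl | rfl
  · congr 1 <;> push_cast <;> ring
  · rw [segment_symm]; congr 1 <;> push_cast <;> ring

/-- The vertical edge at abscissa `s₀` seen from the corner `(s₀, t₀)`.
(Auxiliary.) [cite: MochizukiAbsTopIII2015, Proposition 2.5 (proof) pp.55–57] -/
theorem image_frame_vertical_corner {z v w : ℂ} {A : ℂ → ℂ}
    (hA : ∀ p : ℂ, A p = z + (p.re : ℂ) * v + (p.im : ℂ) * w) {s₀ t₀ : ℝ} (ht : t₀ = 0 ∨ t₀ = 1) :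
    A '' ({s₀} ×ℂ Icc 0 1) = segment ℝ (z + (s₀ : ℂ) * v + (t₀ : ℂ) * w)
      (z + (s₀ : ℂ) * v + (t₀ : ℂ) * w + ((1 - 2 * t₀ : ℝ) : ℂ) * w) := by
  rw [image_frame_const_Icc hA]
  rcases ht with rfl | rfl
  · congr 1 <;> push_cast <;> ring
  · rw [segment_symm]; congr 1 <;> push_cast <;> ring

/-- Re-signing the vectors of an independent pair keeps it independent.
(Auxiliary.) [cite: MochizukiAbsTopIII2015, Proposition 2.5 (proof) pp.55–57] -/
theorem linearIndependent_pair_smul {v w : ℂ} (h : LinearIndependent ℝ ![v, w]) {a b : ℝ} (ha : a ≠ 0)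
    (hb : b ≠ 0) : LinearIndependent ℝ ![(a : ℂ) * v, (b : ℂ) * w] := by
  rw [LinearIndependent.pair_iff] at h ⊢
  intro s t hst
  have := h (s * a) (t * b) (by
    rw [Complex.real_smul, Complex.real_smul] at hst ⊢; push_cast; linear_combination hst)
  exact ⟨(mul_eq_zero.1 this.1).resolve_right ha, (mul_eq_zero.1 this.2).resolve_right hb⟩

/-! ### Prop 2.5 (d): frames are corners -/

/-- **Prop 2.5 (d)**, frames: for `𝒮(U) ⊆ 𝒬 ⊆ 𝒫(U)`, a frame `(P, (S₁, S₂))` of `(U, 𝒬)` at `p` is a corner of a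
genuine parallelogram: `val '' P = openParallelogram p e₁ e₂`, `val '' S₁ = [p, p + e₁]`,
`val '' S₂ = [p, p + e₂]` with `e₁, e₂` `ℝ`-independent and `P̄ ⊆ U`.
[cite: MochizukiAbsTopIII2015, Proposition 2.5 (d) p.56] -/
theorem Parallelograms.IsFrameOf.exists_vectors {U : Set ℂ} (hU : IsOpen U) {𝒬 : Set (Set U)}
    (h𝒬 : ∀ Q ∈ 𝒬, Subtype.val '' Q ∈ parallelogramsIn U)
    (h𝒮 : ∀ Q : Set U, Subtype.val '' Q ∈ squaresIn U → Q ∈ 𝒬) {p : U} {P : Set U} {F : Set U × Set U}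
    (hF : Parallelograms.IsFrameOf 𝒬 p P F) :
    ∃ e₁ e₂ : ℂ, LinearIndependent ℝ ![e₁, e₂] ∧ Subtype.val '' P = openParallelogram p e₁ e₂ ∧
      closure (openParallelogram (p : ℂ) e₁ e₂) ⊆ U ∧
      Subtype.val '' F.1 = segment ℝ (p : ℂ) (p + e₁) ∧ Subtype.val '' F.2 = segment ℝ (p : ℂ) (p + e₂) := by
  obtain ⟨hP, hS₁, hS₂, hne, hint⟩ := hF
  rw [Parallelograms.parallelograms_eq_of_subset hU h𝒬 h𝒮] at hP hS₁ hS₂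
  have hPmem := hP
  obtain ⟨z, v, w, hvw, hPe, hcl⟩ := hP
  rw [hPe] at hcl
  obtain ⟨A, hA⟩ := exists_homeomorph_frame z v w hvw
  have h𝒬' : ∀ Q ∈ {P : Set U | Subtype.val '' P ∈ parallelogramsIn U}, Subtype.val '' Q ∈ parallelogramsIn U :=
    fun _ h => h
  have h𝒮' : ∀ Q : Set U, Subtype.val '' Q ∈ squaresIn U →
      Q ∈ {P : Set U | Subtype.val '' P ∈ parallelogramsIn U} :=
    fun _ h => squaresIn_subset_parallelogramsIn U h
  obtain ⟨E₁, hE₁, hF₁⟩ := (Parallelograms.isSide_iff_of_subset hU h𝒬' h𝒮' hPmem hPe hvw hcl hA).1 hS₁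
  obtain ⟨E₂, hE₂, hF₂⟩ := (Parallelograms.isSide_iff_of_subset hU h𝒬' h𝒮' hPmem hPe hvw hcl hA).1 hS₂
  have hFF : F.1 ∩ F.2 = Subtype.val ⁻¹' (A '' (E₁ ∩ E₂)) := by
    rw [hF₁, hF₂, ← preimage_inter, ← image_inter A.injective]
  rcases sq_edges_cases hE₁ hE₂ with heq | hdis | ⟨s₀, t₀, hs, ht, hor⟩
  · exact absurd (by rw [hF₁, hF₂, heq]) hne
  · exfalso
    have hp : p ∈ F.1 ∩ F.2 := by rw [hint]; exact mem_singleton p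
    rw [hFF, hdis, image_empty] at hp
    exact hp
  · have hcorner : E₁ ∩ E₂ = {(⟨s₀, t₀⟩ : ℂ)} := by
      rcases hor with ⟨rfl, rfl⟩ | ⟨rfl, rfl⟩
      · exact sq_edges_inter_eq_corner hs ht
      · rw [inter_comm]; exact sq_edges_inter_eq_corner hs ht
    have hpA : (p : ℂ) = z + (s₀ : ℂ) * v + (t₀ : ℂ) * w := by
      have hp : p ∈ F.1 ∩ F.2 := by rw [hint]; exact mem_singleton p
      rw [hFF, hcorner, image_singleton] at hp
      have : (p : ℂ) = A ⟨s₀, t₀⟩ := hp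
      rw [this, hA]
    have hs' : (1 - 2 * s₀ : ℝ) ≠ 0 := by rcases hs with rfl | rfl <;> norm_num
    have ht' : (1 - 2 * t₀ : ℝ) ≠ 0 := by rcases ht with rfl | rfl <;> norm_num
    have hPc := (openParallelogram_corner (z := z) (v := v) (w := w) hs ht).symm
    have hH := image_frame_horizontal_corner hA (t₀ := t₀) hs
    have hV := image_frame_vertical_corner hA (s₀ := s₀) ht
    rw [← hpA] at hPc hH hV
    rcases hor with ⟨rfl, rfl⟩ | ⟨rfl, rfl⟩
    · refine ⟨_, _, linearIndependent_pair_smul hvw hs' ht', hPe.trans hPc, hPc ▸ hcl, ?_, ?_⟩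
      · rw [hF₁, ← hH, image_preimage_eq_inter_range, Subtype.range_coe, inter_eq_left]
        exact hH ▸ (hH ▸ (image_mono (sq_edge_subset_boundary hE₁))).trans
          ((closure_diff_openParallelogram_eq_image hvw hA).symm.le.trans (sdiff_subset.trans hcl))
      · rw [hF₂, ← hV, image_preimage_eq_inter_range, Subtype.range_coe, inter_eq_left]
        exact (image_mono (sq_edge_subset_boundary hE₂)).trans
          ((closure_diff_openParallelogram_eq_image hvw hA).symm.le.trans (sdiff_subset.trans hcl))
    · refine ⟨_, _, linearIndependent_pair_smul (LinearIndependent.pair_symm_iff.mp hvw) ht' hs',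
        hPe.trans (hPc.trans (openParallelogram_comm _ _ _).symm),
        (openParallelogram_comm _ _ _).symm ▸ hPc ▸ hcl, ?_, ?_⟩
      · rw [hF₁, ← hV, image_preimage_eq_inter_range, Subtype.range_coe, inter_eq_left]
        exact (image_mono (sq_edge_subset_boundary hE₁)).trans
          ((closure_diff_openParallelogram_eq_image hvw hA).symm.le.trans (sdiff_subset.trans hcl))
      · rw [hF₂, ← hH, image_preimage_eq_inter_range, Subtype.range_coe, inter_eq_left]
        exact (image_mono (sq_edge_subset_boundary hE₂)).trans
          ((closure_diff_openParallelogram_eq_image hvw hA).symm.le.trans (sdiff_subset.trans hcl))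

/-- **Prop 2.5 (d)**, frames from corners: for `e₁, e₂` `ℝ`-independent with the closure of
`P = openParallelogram p e₁ e₂` inside `U`, the pair of edges `([p, p+e₁], [p, p+e₂])` of `P` is a frame of
`(U, 𝒬)` at `p`. [cite: MochizukiAbsTopIII2015, Proposition 2.5 (d) p.56] -/
theorem Parallelograms.isFrameOf_of_vectors {U : Set ℂ} (hU : IsOpen U) {𝒬 : Set (Set U)}
    (h𝒬 : ∀ Q ∈ 𝒬, Subtype.val '' Q ∈ parallelogramsIn U)
    (h𝒮 : ∀ Q : Set U, Subtype.val '' Q ∈ squaresIn U → Q ∈ 𝒬) {p : U} {e₁ e₂ : ℂ}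
    (he : LinearIndependent ℝ ![e₁, e₂]) (hcl : closure (openParallelogram (p : ℂ) e₁ e₂) ⊆ U) :
    Parallelograms.IsFrameOf 𝒬 p (Subtype.val ⁻¹' openParallelogram (p : ℂ) e₁ e₂)
      (Subtype.val ⁻¹' segment ℝ (p : ℂ) (p + e₁), Subtype.val ⁻¹' segment ℝ (p : ℂ) (p + e₂)) := by
  obtain ⟨A, hA⟩ := exists_homeomorph_frame (p : ℂ) e₁ e₂ he
  have himg : ∀ {T : Set ℂ}, T ⊆ U → Subtype.val '' (Subtype.val ⁻¹' T : Set U) = T := fun hT => by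
    rw [image_preimage_eq_inter_range, Subtype.range_coe, inter_eq_left.2 hT]
  have hPU : openParallelogram (p : ℂ) e₁ e₂ ⊆ U := subset_closure.trans hcl
  have hPmem : (Subtype.val ⁻¹' openParallelogram (p : ℂ) e₁ e₂ : Set U) ∈
      {P : Set U | Subtype.val '' P ∈ parallelogramsIn U} :=
    ⟨p, e₁, e₂, he, himg hPU, by rw [himg hPU]; exact hcl⟩
  have h𝒬' : ∀ Q ∈ {P : Set U | Subtype.val '' P ∈ parallelogramsIn U}, Subtype.val '' Q ∈ parallelogramsIn U :=
    fun _ h => h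
  have h𝒮' : ∀ Q : Set U, Subtype.val '' Q ∈ squaresIn U →
      Q ∈ {P : Set U | Subtype.val '' P ∈ parallelogramsIn U} :=
    fun _ h => squaresIn_subset_parallelogramsIn U h
  have hE0 : A '' (Icc 0 1 ×ℂ {(0 : ℝ)}) = segment ℝ (p : ℂ) (p + e₁) := by
    rw [image_frame_Icc_const hA]; simp
  have hE3 : A '' ({(0 : ℝ)} ×ℂ Icc 0 1) = segment ℝ (p : ℂ) (p + e₂) := by
    rw [image_frame_const_Icc hA]; simp
  have hK := convex_closure_openParallelogram (p : ℂ) e₁ e₂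
  have hp0 : (p : ℂ) ∈ closure (openParallelogram (p : ℂ) e₁ e₂) :=
    (mem_closure_openParallelogram_iff he).2 ⟨0, 0, le_rfl, zero_le_one, le_rfl, zero_le_one, by simp⟩
  have hp1 : (p : ℂ) + e₁ ∈ closure (openParallelogram (p : ℂ) e₁ e₂) :=
    (mem_closure_openParallelogram_iff he).2 ⟨1, 0, zero_le_one, le_rfl, le_rfl, zero_le_one, by simp⟩
  have hp2 : (p : ℂ) + e₂ ∈ closure (openParallelogram (p : ℂ) e₁ e₂) :=
    (mem_closure_openParallelogram_iff he).2 ⟨0, 1, le_rfl, zero_le_one, zero_le_one, le_rfl, by simp⟩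
  have hS₁U : segment ℝ (p : ℂ) (p + e₁) ⊆ U := (hK.segment_subset hp0 hp1).trans hcl
  have hS₂U : segment ℝ (p : ℂ) (p + e₂) ⊆ U := (hK.segment_subset hp0 hp2).trans hcl
  refine ⟨?_, ?_, ?_, ?_, ?_⟩
  · rw [Parallelograms.parallelograms_eq_of_subset hU h𝒬 h𝒮]; exact hPmem
  · rw [Parallelograms.parallelograms_eq_of_subset hU h𝒬 h𝒮]
    exact (Parallelograms.isSide_iff_of_subset hU h𝒬' h𝒮' hPmem (himg hPU) he hcl hA).2
      ⟨_, Or.inl rfl, by rw [hE0]⟩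
  · rw [Parallelograms.parallelograms_eq_of_subset hU h𝒬 h𝒮]
    exact (Parallelograms.isSide_iff_of_subset hU h𝒬' h𝒮' hPmem (himg hPU) he hcl hA).2
      ⟨_, Or.inr (Or.inr (Or.inl rfl)), by rw [hE3]⟩
  · intro h
    have hseg : segment ℝ (p : ℂ) (p + e₁) = segment ℝ (p : ℂ) (p + e₂) := by
      rw [← himg hS₁U, ← himg hS₂U]; exact congrArg _ h
    have hmem : (p : ℂ) + e₁ ∈ segment ℝ (p : ℂ) (p + e₂) := hseg ▸ right_mem_segment ℝ _ _
    rw [segment_eq_image_lineMap] at hmem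
    obtain ⟨θ, -, hθ⟩ := hmem
    rw [lineMap_apply_complex] at hθ
    have := (LinearIndependent.pair_iff.1 he) 1 (-θ) (by
      rw [Complex.real_smul, Complex.real_smul]; push_cast; linear_combination -hθ)
    norm_num at this
  · show Subtype.val ⁻¹' segment ℝ (p : ℂ) (p + e₁) ∩ Subtype.val ⁻¹' segment ℝ (p : ℂ) (p + e₂) = {p}
    rw [← hE0, ← hE3, ← preimage_inter, ← image_inter A.injective,
      sq_edges_inter_eq_corner (s := 0) (t := 0) (Or.inl rfl) (Or.inl rfl), image_singleton]
    have : A ⟨0, 0⟩ = p := by rw [hA]; simp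
    rw [this]
    ext e
    simp only [mem_preimage, mem_singleton_iff]
    exact Subtype.ext_iff.symm

/-! ### Prop 2.5 (d): strict co-orientation preserves the orientation sign -/

/-- The corner `p` does not lie in the open parallelogram with corner `p`.
(Auxiliary.) [cite: MochizukiAbsTopIII2015, Proposition 2.5 (proof) pp.55–57] -/
theorem corner_notMem_openParallelogram {p e₁ e₂ : ℂ} (he : LinearIndependent ℝ ![e₁, e₂]) :
    p ∉ openParallelogram p e₁ e₂ := by
  rintro ⟨s, t, hs, -, ht, -, h⟩
  have := (LinearIndependent.pair_iff.1 he) s t (by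
    rw [Complex.real_smul, Complex.real_smul]; linear_combination -h)
  linarith [this.1]

/-- If the segment `[p, p + f]` meets the open parallelogram `openParallelogram p e₁ e₂`, then `f` is a
positive combination of `e₁, e₂` ("`[p, p+f]` is framed by the frame `(e₁, e₂)` at `p`").
(Auxiliary.) [cite: MochizukiAbsTopIII2015, Proposition 2.5 (d) p.56] -/
theorem exists_pos_coeffs_of_segment_meets {p f e₁ e₂ : ℂ} (he : LinearIndependent ℝ ![e₁, e₂])
    (h : (segment ℝ p (p + f) ∩ openParallelogram p e₁ e₂).Nonempty) :
    ∃ α β : ℝ, 0 < α ∧ 0 < β ∧ f = (α : ℂ) * e₁ + (β : ℂ) * e₂ := by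
  obtain ⟨x, hx1, hx2⟩ := h
  rw [segment_eq_image_lineMap] at hx1
  obtain ⟨r, ⟨hr0, -⟩, rfl⟩ := hx1
  obtain ⟨s, t, hs, -, ht, -, hx⟩ := hx2
  rw [lineMap_apply_complex, add_sub_cancel_left] at hx
  have hr : r ≠ 0 := by
    rintro rfl
    have := (LinearIndependent.pair_iff.1 he) s t (by
      rw [Complex.real_smul, Complex.real_smul]; simp at hx; linear_combination -hx)
    linarith [this.1]
  have hr' : 0 < r := lt_of_le_of_ne hr0 (Ne.symm hr)
  refine ⟨s / r, t / r, div_pos hs hr', div_pos ht hr', ?_⟩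
  have hrC : (r : ℂ) ≠ 0 := by exact_mod_cast hr
  push_cast
  field_simp
  linear_combination hx

/-- The determinant sign is preserved under the two "framed by" relations of a strict co-orientation.
(Auxiliary.) [cite: MochizukiAbsTopIII2015, Proposition 2.5 (d) p.56] -/
theorem det_pos_iff_of_pos_coeffs {e₁ e₂ f₁ f₂ : ℂ} {α β γ δ : ℝ} (hα : 0 < α) (hδ : 0 < δ)
    (h1 : f₁ = (α : ℂ) * e₁ + (β : ℂ) * e₂) (h2 : e₂ = (γ : ℂ) * f₁ + (δ : ℂ) * f₂) :
    (0 < e₁.re * e₂.im - e₁.im * e₂.re ↔ 0 < f₁.re * f₂.im - f₁.im * f₂.re) := by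
  have hf1re : f₁.re = α * e₁.re + β * e₂.re := by rw [h1]; simp
  have hf1im : f₁.im = α * e₁.im + β * e₂.im := by rw [h1]; simp
  have he2re : e₂.re = γ * f₁.re + δ * f₂.re := by
    conv_lhs => rw [h2]
    simp
  have he2im : e₂.im = γ * f₁.im + δ * f₂.im := by
    conv_lhs => rw [h2]
    simp
  have key : α * (e₁.re * e₂.im - e₁.im * e₂.re) = δ * (f₁.re * f₂.im - f₁.im * f₂.re) := by
    linear_combination (-e₂.im) * hf1re + e₂.re * hf1im + (-f₁.im) * he2re + f₁.re * he2im
  constructor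
  · intro h; nlinarith [mul_pos hα h]
  · intro h; nlinarith [mul_pos hδ h]

/-- **Prop 2.5 (d)**, the orientation sign: if two frames at `p`, with corner data `(e₁, e₂)` and
`(e₁', e₂')`, are STRICTLY CO-ORIENTED, then `det(e₁, e₂)` and `det(e₁', e₂')` have the same sign.
[cite: MochizukiAbsTopIII2015, Proposition 2.5 (d) p.56] -/
theorem Parallelograms.StrictlyCoOriented.det_pos_iff {U : Set ℂ} {𝒬 : Set (Set U)} {p : U}
    {P P' : Set U} {F F' : Set U × Set U} {e₁ e₂ e₁' e₂' : ℂ}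
    (hco : Parallelograms.StrictlyCoOriented 𝒬 P F P' F')
    (he : LinearIndependent ℝ ![e₁, e₂]) (he' : LinearIndependent ℝ ![e₁', e₂'])
    (hP : Subtype.val '' P = openParallelogram (p : ℂ) e₁ e₂)
    (h₂ : Subtype.val '' F.2 = segment ℝ (p : ℂ) (p + e₂))
    (hP' : Subtype.val '' P' = openParallelogram (p : ℂ) e₁' e₂')
    (h₁' : Subtype.val '' F'.1 = segment ℝ (p : ℂ) (p + e₁')) :
    (0 < e₁.re * e₂.im - e₁.im * e₂.re ↔ 0 < e₁'.re * e₂'.im - e₁'.im * e₂'.re) := by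
  obtain ⟨⟨-, hinf₁⟩, ⟨-, hinf₂⟩⟩ := hco
  have hne₁ : (segment ℝ (p : ℂ) (p + e₁') ∩ openParallelogram (p : ℂ) e₁ e₂).Nonempty := by
    rw [← h₁', ← hP, ← image_inter Subtype.val_injective]
    exact hinf₁.nonempty.image _
  have hne₂ : (segment ℝ (p : ℂ) (p + e₂) ∩ openParallelogram (p : ℂ) e₁' e₂').Nonempty := by
    rw [← h₂, ← hP', ← image_inter Subtype.val_injective]
    exact hinf₂.nonempty.image _
  obtain ⟨α, β, hα, hβ, hαβ⟩ := exists_pos_coeffs_of_segment_meets he hne₁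
  obtain ⟨γ, δ, hγ, hδ, hγδ⟩ := exists_pos_coeffs_of_segment_meets he' hne₂
  exact det_pos_iff_of_pos_coeffs hα hδ hαβ hγδ

/-! ### Frames of both signs exist at every point -/

/-- At every point `p` of an open `U ⊆ ℂ` there is `ε > 0` such that the squares with corner `p` and edge
vectors `(ε, ε i)` resp. `(ε i, ε)` — frames of opposite orientation signs — have closures inside `U`.
(Auxiliary.) [cite: MochizukiAbsTopIII2015, Proposition 2.5 (d) p.56] -/
theorem exists_small_corner_squares {U : Set ℂ} (hU : IsOpen U) {p : ℂ} (hp : p ∈ U) :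
    ∃ ε : ℝ, 0 < ε ∧ closure (openParallelogram p ε (ε * I)) ⊆ U ∧
      closure (openParallelogram p (ε * I) ε) ⊆ U := by
  obtain ⟨r, hr, hball⟩ := Metric.isOpen_iff.1 hU p hp
  have hli : LinearIndependent ℝ ![((r / 3 : ℝ) : ℂ), ((r / 3 : ℝ) : ℂ) * I] := by
    have := linearIndependent_pair_mul_I (v := ((r / 3 : ℝ) : ℂ)) (by exact_mod_cast (by positivity : r / 3 ≠ 0))
    simpa [mul_comm] using this
  refine ⟨r / 3, by positivity, ?_, ?_⟩
  · intro x hx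
    rw [mem_closure_openParallelogram_iff hli] at hx
    obtain ⟨s, t, hs, hs1, ht, ht1, rfl⟩ := hx
    apply hball
    rw [Metric.mem_ball, dist_eq_norm, show p + (s : ℂ) * (r / 3 : ℝ) + (t : ℂ) * ((r / 3 : ℝ) * I) - p =
      ((s * (r / 3) : ℝ) : ℂ) + ((t * (r / 3) : ℝ) : ℂ) * I by push_cast; ring]
    refine (Complex.norm_le_abs_re_add_abs_im _).trans_lt ?_
    have hre : (((s * (r / 3) : ℝ) : ℂ) + ((t * (r / 3) : ℝ) : ℂ) * I).re = s * (r / 3) := by simp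
    have him : (((s * (r / 3) : ℝ) : ℂ) + ((t * (r / 3) : ℝ) : ℂ) * I).im = t * (r / 3) := by simp
    rw [hre, him, abs_of_nonneg (by positivity), abs_of_nonneg (by positivity)]
    nlinarith
  · rw [openParallelogram_comm]
    intro x hx
    rw [mem_closure_openParallelogram_iff hli] at hx
    obtain ⟨s, t, hs, hs1, ht, ht1, rfl⟩ := hx
    apply hball
    rw [Metric.mem_ball, dist_eq_norm, show p + (s : ℂ) * (r / 3 : ℝ) + (t : ℂ) * ((r / 3 : ℝ) * I) - p =
      ((s * (r / 3) : ℝ) : ℂ) + ((t * (r / 3) : ℝ) : ℂ) * I by push_cast; ring]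
    refine (Complex.norm_le_abs_re_add_abs_im _).trans_lt ?_
    have hre : (((s * (r / 3) : ℝ) : ℂ) + ((t * (r / 3) : ℝ) : ℂ) * I).re = s * (r / 3) := by simp
    have him : (((s * (r / 3) : ℝ) : ℂ) + ((t * (r / 3) : ℝ) : ℂ) * I).im = t * (r / 3) := by simp
    rw [hre, him, abs_of_nonneg (by positivity), abs_of_nonneg (by positivity)]
    nlinarith

end

end Literature.AnabelianGeometry.AbsoluteAnabelian
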